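import Literature.Barriers.CriticalPhenomena.TreesPercolatingAtCriticalityWitnessProofs
import Mathlib.Analysis.SpecificLimits.Normed
import HarnessLib

/-!
# Proof of `TreesPercolatingAtCriticalityNarrow` (Lyons–Peres 2016, Exercise 5.12 / 5.51 (b)):
# a tree on `ℕ` of maximal degree `3` and exponential growth percolating at `p_c = 2^{-1/2}`

Discharge of the barrier `Literature.Barriers.CriticalPhenomena.TreesPercolatingAtCriticalityNarrow`
(`TreesPercolatingAtCriticality.lean`) as the sorry-free theorem
`TreesPercolatingAtCriticalityNarrow_holds`, with the witness `narrowSeq.T` of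
`TreesPercolatingAtCriticalityWitness.lean`: the spherically symmetric tree on `ℕ` (root `0`)
with `c n = 2^{narrowE (n+1) - narrowE n} ∈ {1,2}` children per level-`n` vertex,
`|T_n| = 2^{narrowE n}`, `narrowE n = ⌈n/2⌉ + narrowB ⌊n/2⌋`, `narrowB j = ⌊log₂((j+2)(j+3))⌋ - 2`.

## The printed argument (Lyons–Peres 2016) and its formalisation

* `|T_n| = 2^{narrowE n}` (`narrowSeq_N`), child counts `≤ 2` (`narrowSeq_c_le`), so all degrees
  are `≤ 3` (`LevelSeq.ncard_neighborSet_le`); `T` is a tree (`LevelSeq.T_isTree`).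
* `m_k := |T_k| p*^k` at `p* = 2^{-1/2}`: `m_{2j} = 2^{narrowB j}`, `m_{2j+1} = √2 · 2^{narrowB j}`
  (`N_mul_pstar_pow_even/odd`), and `4 · 2^{narrowB j} ≤ (j+2)(j+3) < 8 · 2^{narrowB j}`, whence
  `m_k ≥ (k+3)(k+4)/32` (`sq_le_N_mul_pstar_pow`) and `Σ_{k ≤ n} 1/m_k ≤ 32 Σ (1/(k+3) - 1/(k+4))
  ≤ 32/3` (`sum_inv_N_mul_pstar_pow_le`). By Exercise 5.51 (b) (`LevelSeq.one_div_le_theta`,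
  second-moment method Prop. 5.11) `θ_0(p*) ≥ 3/32 > 0` (`theta_pstar_pos`).
* For `p < p*`: `θ_0(p) ≤ |T_{2j}| p^{2j} = 2^{narrowB j} (2p²)^j ≤ (j+2)(j+3)(2p²)^j/4 → 0`
  (first moment (5.6)/Prop. 5.8, `LevelSeq.theta_le`), so `θ_0(p) = 0`
  (`theta_eq_zero_of_lt_pstar`). Hence `p_c = p*` from the definition of `criticalProb` as an
  infimum (`criticalProb_narrowSeq`; this is `p_c = 1/br T`, `br T = gr T = √2`, ibid. (5.6),
  Thm. 5.15, Exercise 1.2 — the branching number itself is not formalised), `0 < p_c < 1`, and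
  `θ_0(p_c) > 0`.
* Exponential growth: `CriticalTreesExponentialGrowth_holds` (`TreesPercolatingAtCriticalityProofs.lean`,
  Lyons–Peres (5.6) with (1.1)) applied to `p_c < 1`.

## References

* R. Lyons, Y. Peres, *Probability on Trees and Networks*, CUP 2016: Exercise 5.12 (p. 243),
  Exercise 5.51 (b) (p. 268), Prop. 5.8 and (5.6) (p. 229), Prop. 5.11 (p. 231), Thm. 5.15,
  (1.1) (p. 71), Exercise 1.2 (p. 85), Exercise 3.35 (c) (p. 180).
* M. Heydenreich, R. van der Hofstad, *Progress in High-Dimensional Percolation and Random Graphs*,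
  Springer 2017, p. 234 ("one can construct certain trees for which there are … infinite open
  clusters at criticality").
-/

noncomputable section

namespace Literature.Barriers.CriticalPhenomena

open MeasureTheory Finset Filter Topology
open Literature.Probability.Percolation

/-! ### Level sizes of the witness: `|T_n| = 2^{narrowE n}`, child counts `≤ 2` -/

/-- `log₂((j+2)(j+3)) ≥ 2`. [folklore] -/
theorem two_le_log_narrow (j : ℕ) : 2 ≤ Nat.log 2 ((j + 2) * (j + 3)) :=
  Nat.le_log_of_pow_le (by norm_num) (by nlinarith)

/-- `narrowB 0 = 0` (`⌊log₂ 6⌋ = 2`), so `|T_0| = 1`. [folklore] -/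
theorem narrowB_zero : narrowB 0 = 0 := by
  have h : Nat.log 2 6 = 2 := Nat.log_eq_of_pow_le_of_lt_pow (by norm_num) (by norm_num)
  rw [narrowB, show (0 + 2) * (0 + 3) = 6 by norm_num, h]

/-- `narrowB` is monotone. [folklore] -/
theorem narrowB_mono (j : ℕ) : narrowB j ≤ narrowB (j + 1) := by
  unfold narrowB
  have := Nat.log_mono_right (b := 2) (show (j + 2) * (j + 3) ≤ (j + 1 + 2) * (j + 1 + 3) by nlinarith)
  omega

/-- The increments of `narrowB` are `≤ 1` (`(j+3)(j+4) ≤ 2 (j+2)(j+3)`). [folklore] -/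
theorem narrowB_succ_le (j : ℕ) : narrowB (j + 1) ≤ narrowB j + 1 := by
  unfold narrowB
  have h1 : (j + 1 + 2) * (j + 1 + 3) ≤ (j + 2) * (j + 3) * 2 := by nlinarith
  have h2 : Nat.log 2 ((j + 1 + 2) * (j + 1 + 3)) ≤ Nat.log 2 ((j + 2) * (j + 3) * 2) :=
    Nat.log_mono_right h1
  have h3 : Nat.log 2 ((j + 2) * (j + 3) * 2) = Nat.log 2 ((j + 2) * (j + 3)) + 1 :=
    Nat.log_mul_base (by norm_num) (by positivity)
  have := two_le_log_narrow j
  omega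

/-- `narrowE 0 = 0`. [folklore] -/
theorem narrowE_zero : narrowE 0 = 0 := by simp [narrowE, narrowB_zero]

/-- `narrowE (2j) = j + narrowB j`. [folklore] -/
theorem narrowE_even (j : ℕ) : narrowE (2 * j) = j + narrowB j := by
  unfold narrowE
  have h1 : (2 * j + 1) / 2 = j := by omega
  have h2 : 2 * j / 2 = j := by omega
  rw [h1, h2]

/-- `narrowE (2j+1) = j + 1 + narrowB j`. [folklore] -/
theorem narrowE_odd (j : ℕ) : narrowE (2 * j + 1) = j + 1 + narrowB j := by
  unfold narrowE
  have h1 : (2 * j + 1 + 1) / 2 = j + 1 := by omega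
  have h2 : (2 * j + 1) / 2 = j := by omega
  rw [h1, h2]

/-- The increments of `narrowE` lie in `{0, 1}` (branching at every even height, and at the odd
height `2j+1` iff `narrowB` jumps at `j`). [cite: LyonsPeres2016, Exercise 3.35 (c) (p. 180)] -/
theorem narrowE_le_succ (n : ℕ) : narrowE n ≤ narrowE (n + 1) ∧ narrowE (n + 1) ≤ narrowE n + 1 := by
  obtain ⟨j, rfl | rfl⟩ := Nat.even_or_odd' n
  · rw [narrowE_even, narrowE_odd]
    omega
  · rw [narrowE_odd, show 2 * j + 1 + 1 = 2 * (j + 1) by ring, narrowE_even]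
    have := narrowB_mono j
    have := narrowB_succ_le j
    omega

/-- **Every vertex of the witness has at most `2` children** (so all degrees are `≤ 3`).
[cite: LyonsPeres2016, Exercise 3.35 (c) (p. 180)] -/
theorem narrowSeq_c_le (n : ℕ) : narrowSeq.c n ≤ 2 := by
  rw [narrowSeq_c]
  have h := (narrowE_le_succ n).2
  calc 2 ^ (narrowE (n + 1) - narrowE n) ≤ 2 ^ 1 := Nat.pow_le_pow_right (by norm_num) (by omega)
    _ = 2 := by norm_num

/-- **Level sizes of the witness: `|T_n| = 2^{narrowE n}`.** [cite: LyonsPeres2016, Exercise 3.35 (c) (p. 180)] -/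
theorem narrowSeq_N (n : ℕ) : narrowSeq.N n = 2 ^ narrowE n := by
  induction n with
  | zero => rw [LevelSeq.N_zero, narrowE_zero, pow_zero]
  | succ n ih =>
    rw [LevelSeq.N_succ, ih, narrowSeq_c, ← pow_add]
    congr 1
    have := (narrowE_le_succ n).1
    omega

/-- `(j+2)(j+3) < 8 · 2^{narrowB j}` (`2^{narrowB j} ≍ j²`, lower bound). [folklore] -/
theorem lt_eight_mul_two_pow_narrowB (j : ℕ) : (j + 2) * (j + 3) < 8 * 2 ^ narrowB j := by
  have h1 := Nat.lt_pow_succ_log_self (b := 2) (by norm_num) ((j + 2) * (j + 3))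
  have h2 := two_le_log_narrow j
  unfold narrowB
  have : 8 * 2 ^ (Nat.log 2 ((j + 2) * (j + 3)) - 2) = 2 ^ (Nat.log 2 ((j + 2) * (j + 3))).succ := by
    rw [show 8 = 2 ^ 3 by norm_num, ← pow_add]
    congr 1
    omega
  rw [this]
  exact h1

/-- `4 · 2^{narrowB j} ≤ (j+2)(j+3)` (`2^{narrowB j} ≍ j²`, upper bound). [folklore] -/
theorem four_mul_two_pow_narrowB_le (j : ℕ) : 4 * 2 ^ narrowB j ≤ (j + 2) * (j + 3) := by
  have h1 := Nat.pow_log_le_self 2 (show (j + 2) * (j + 3) ≠ 0 by positivity)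
  have h2 := two_le_log_narrow j
  unfold narrowB
  have : 4 * 2 ^ (Nat.log 2 ((j + 2) * (j + 3)) - 2) = 2 ^ (Nat.log 2 ((j + 2) * (j + 3))) := by
    rw [show 4 = 2 ^ 2 by norm_num, ← pow_add]
    congr 1
    omega
  rw [this]
  exact h1

/-- `2 p* = √2`. [folklore] -/
theorem two_mul_pstar : 2 * pstar = Real.sqrt 2 := by unfold pstar; ring

/-- `1 ≤ 2 p*`. [folklore] -/
theorem one_le_two_mul_pstar : 1 ≤ 2 * pstar := by
  rw [two_mul_pstar]
  exact Real.one_le_sqrt.2 (by norm_num)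

/-- `m_{2j} = |T_{2j}| p*^{2j} = 2^{narrowB j}`. [cite: LyonsPeres2016, Exercise 5.51 (p. 268, m_n)] -/
theorem N_mul_pstar_pow_even (j : ℕ) :
    (narrowSeq.N (2 * j) : ℝ) * pstar ^ (2 * j) = 2 ^ narrowB j := by
  rw [narrowSeq_N, narrowE_even, pow_mul, Nat.cast_pow, Nat.cast_ofNat, pow_add, pstar_sq]
  calc (2 : ℝ) ^ j * 2 ^ narrowB j * (1 / 2) ^ j = (2 * (1 / 2)) ^ j * 2 ^ narrowB j := by
        rw [mul_pow]; ring
    _ = 2 ^ narrowB j := by norm_num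

/-- `m_{2j+1} = |T_{2j+1}| p*^{2j+1} = √2 · 2^{narrowB j}`. [cite: LyonsPeres2016, Exercise 5.51 (p. 268, m_n)] -/
theorem N_mul_pstar_pow_odd (j : ℕ) :
    (narrowSeq.N (2 * j + 1) : ℝ) * pstar ^ (2 * j + 1) = (2 * pstar) * 2 ^ narrowB j := by
  rw [narrowSeq_N, narrowE_odd, pow_succ, pow_mul, Nat.cast_pow, Nat.cast_ofNat, pow_add,
    pow_succ, pstar_sq]
  calc (2 : ℝ) ^ j * 2 * 2 ^ narrowB j * ((1 / 2) ^ j * pstar)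
        = (2 * (1 / 2)) ^ j * (2 * pstar) * 2 ^ narrowB j := by rw [mul_pow]; ring
    _ = (2 * pstar) * 2 ^ narrowB j := by norm_num

/-- **`m_k = |T_k| p*^k ≥ (k+3)(k+4)/32`** (`m_k ≍ k²`, the expected number of level-`k` vertices
joined to the root at `p = p*`). [cite: LyonsPeres2016, Exercise 5.51 (p. 268, m_n)] -/
theorem sq_le_N_mul_pstar_pow (k : ℕ) :
    ((k + 3) * (k + 4) : ℝ) / 32 ≤ (narrowSeq.N k : ℝ) * pstar ^ k := by
  obtain ⟨j, rfl | rfl⟩ := Nat.even_or_odd' k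
  · rw [N_mul_pstar_pow_even]
    have h' : ((j + 2) * (j + 3) : ℝ) < 8 * 2 ^ narrowB j := by
      exact_mod_cast lt_eight_mul_two_pow_narrowB j
    have hj : (0 : ℝ) ≤ j := Nat.cast_nonneg j
    rw [div_le_iff₀ (by norm_num : (0 : ℝ) < 32)]
    push_cast
    nlinarith
  · rw [N_mul_pstar_pow_odd]
    have h' : ((j + 2) * (j + 3) : ℝ) < 8 * 2 ^ narrowB j := by
      exact_mod_cast lt_eight_mul_two_pow_narrowB j
    have hj : (0 : ℝ) ≤ j := Nat.cast_nonneg j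
    have h2 : (2 : ℝ) ^ narrowB j ≤ (2 * pstar) * 2 ^ narrowB j :=
      le_mul_of_one_le_left (by positivity) one_le_two_mul_pstar
    rw [div_le_iff₀ (by norm_num : (0 : ℝ) < 32)]
    push_cast
    nlinarith

/-- **`Σ_k 1/m_k < ∞`: the partial sums `Σ_{k ≤ n} 1/m_k` are bounded by `32/3`** (telescoping
`32 (1/(k+3) - 1/(k+4))`). [cite: LyonsPeres2016, Exercise 5.51 (b) (p. 268)] -/
theorem sum_inv_N_mul_pstar_pow_le (n : ℕ) :
    ∑ k ∈ range (n + 1), ((narrowSeq.N k : ℝ) * pstar ^ k)⁻¹ ≤ 32 / 3 := by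
  have hterm : ∀ k ∈ range (n + 1), ((narrowSeq.N k : ℝ) * pstar ^ k)⁻¹ ≤
      32 * (1 / ((k : ℝ) + 3) - 1 / ((((k + 1 : ℕ)) : ℝ) + 3)) := by
    intro k _
    have hlow := sq_le_N_mul_pstar_pow k
    have hpos : (0 : ℝ) < ((k + 3) * (k + 4) : ℝ) / 32 := by positivity
    calc ((narrowSeq.N k : ℝ) * pstar ^ k)⁻¹ ≤ (((k + 3) * (k + 4) : ℝ) / 32)⁻¹ :=
          inv_anti₀ hpos hlow
      _ = 32 * (1 / ((k : ℝ) + 3) - 1 / ((((k + 1 : ℕ)) : ℝ) + 3)) := by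
          push_cast
          field_simp
          ring
  calc ∑ k ∈ range (n + 1), ((narrowSeq.N k : ℝ) * pstar ^ k)⁻¹
      ≤ ∑ k ∈ range (n + 1), 32 * (1 / ((k : ℝ) + 3) - 1 / ((((k + 1 : ℕ)) : ℝ) + 3)) :=
        Finset.sum_le_sum hterm
    _ = 32 * (1 / ((0 : ℕ) + 3 : ℝ) - 1 / (((n + 1 : ℕ) : ℝ) + 3)) := by
        rw [← Finset.mul_sum, Finset.sum_range_sub' (fun k : ℕ => 1 / ((k : ℝ) + 3)) (n + 1)]
    _ ≤ 32 / 3 := by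
        have : (0 : ℝ) < 1 / (((n + 1 : ℕ) : ℝ) + 3) := by positivity
        push_cast at this ⊢
        linarith

/-- **Percolation at `p* = 2^{-1/2}`: `θ_0(p*) ≥ 3/32 > 0`** (Exercise 5.51 (b): `Σ 1/m_n < ∞`).
[cite: LyonsPeres2016, Exercise 5.51 (b) (p. 268) and Exercise 5.12 (p. 243)] -/
theorem theta_pstar_pos : 0 < theta narrowSeq.T 0 pstarI := by
  have h := narrowSeq.one_div_le_theta pstarI pstar_pos (S := 32 / 3) sum_inv_N_mul_pstar_pow_le
  have : (0 : ℝ) < 1 / (32 / 3) := by norm_num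
  linarith

/-- **No percolation below `p*`: `θ_0(p) = 0` for `p < p*`** (first moment along even levels:
`|T_{2j}| p^{2j} = 2^{narrowB j} (2p²)^j ≤ (j+2)(j+3) (2p²)^j / 4 → 0`; this is `p_c ≥ 1/br T`,
(5.6)). [cite: LyonsPeres2016, Prop. 5.8 and (5.6) (p. 229)] -/
theorem theta_eq_zero_of_lt_pstar {p : unitInterval} (hp : (p : ℝ) < pstar) :
    theta narrowSeq.T 0 p = 0 := by
  set r : ℝ := 2 * (p : ℝ) ^ 2 with hr
  have hr0 : 0 ≤ r := by positivity
  have hr1 : r < 1 := by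
    have : (p : ℝ) ^ 2 < pstar ^ 2 := pow_lt_pow_left₀ hp p.2.1 two_ne_zero
    rw [pstar_sq] at this
    rw [hr]
    linarith
  have hb : ∀ j : ℕ, theta narrowSeq.T 0 p ≤
      ((j : ℝ) ^ 2 * r ^ j + 5 * ((j : ℝ) * r ^ j) + 6 * r ^ j) / 4 := by
    intro j
    have h1 := narrowSeq.theta_le p (2 * j)
    rw [narrowSeq_N, narrowE_even] at h1
    push_cast at h1
    have h2 : (2 : ℝ) ^ (j + narrowB j) * (p : ℝ) ^ (2 * j) = 2 ^ narrowB j * r ^ j := by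
      rw [pow_add, pow_mul, hr, mul_pow]
      ring
    have h3 : (4 : ℝ) * 2 ^ narrowB j ≤ (j + 2) * (j + 3) := by
      exact_mod_cast four_mul_two_pow_narrowB_le j
    have h4 : 0 ≤ r ^ j := pow_nonneg hr0 j
    calc theta narrowSeq.T 0 p ≤ 2 ^ narrowB j * r ^ j := by rw [← h2]; exact h1
      _ ≤ ((j + 2) * (j + 3) / 4) * r ^ j := mul_le_mul_of_nonneg_right (by linarith) h4
      _ = ((j : ℝ) ^ 2 * r ^ j + 5 * ((j : ℝ) * r ^ j) + 6 * r ^ j) / 4 := by ring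
  have hlim : Tendsto (fun j : ℕ => ((j : ℝ) ^ 2 * r ^ j + 5 * ((j : ℝ) * r ^ j) + 6 * r ^ j) / 4)
      atTop (𝓝 0) := by
    have t2 := tendsto_pow_const_mul_const_pow_of_lt_one 2 hr0 hr1
    have t1 := tendsto_self_mul_const_pow_of_lt_one hr0 hr1
    have t0 := tendsto_pow_atTop_nhds_zero_of_lt_one hr0 hr1
    have := ((t2.add (t1.const_mul 5)).add (t0.const_mul 6)).div_const 4
    simpa using this
  have hle : theta narrowSeq.T 0 p ≤ 0 := ge_of_tendsto' hlim hb
  have hge : 0 ≤ theta narrowSeq.T 0 p := by unfold theta; exact measureReal_nonneg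
  exact le_antisymm hle hge

/-- **`p_c(T, 0) = p* = 2^{-1/2}` for the witness tree** (`= 1/br T`, `br T = gr T = √2`; here from
`θ_0 = 0` below `p*`, `θ_0(p*) > 0`, and `criticalProb` = the infimum of the percolating parameters).
[cite: LyonsPeres2016, (5.6) (p. 229), Thm. 5.15 and Exercise 1.2 (p. 85)] -/
theorem criticalProb_narrowSeq : criticalProb narrowSeq.T 0 = pstar := by
  apply le_antisymm
  · refine csInf_le ⟨0, ?_⟩ (Or.inl ⟨pstarI.2, theta_pstar_pos⟩)
    rintro q (⟨hq, -⟩ | hq)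
    · exact hq.1
    · rw [Set.mem_singleton_iff] at hq
      rw [hq]
      exact zero_le_one
  · refine le_csInf ⟨1, Or.inr rfl⟩ ?_
    rintro q (⟨hq, hθ⟩ | hq)
    · rcases lt_or_ge q pstar with hlt | hge
      · have h0 := theta_eq_zero_of_lt_pstar (p := ⟨q, hq⟩) hlt
        rw [h0] at hθ
        exact absurd hθ (lt_irrefl _)
      · exact hge
    · rw [Set.mem_singleton_iff] at hq
      rw [hq]
      exact pstar_lt_one.le

/-- **Discharge of the barrier `TreesPercolatingAtCriticalityNarrow` (Lyons–Peres 2016, Exercise 5.12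
with Exercise 5.51 (b); Heydenreich–van der Hofstad 2017, p. 234):** the spherically symmetric
`{1,2}`-tree `narrowSeq.T` on `ℕ` is a tree with all degrees `≤ 3`, exponential growth,
`p_c = 2^{-1/2} ∈ (0, 1)` and `θ_0(p_c) > 0`.
[cite: LyonsPeres2016, Exercise 5.12 (p. 243) and Exercise 5.51 (b) (p. 268)] -/
theorem TreesPercolatingAtCriticalityNarrow_holds : TreesPercolatingAtCriticalityNarrow := by
  refine ⟨narrowSeq.T, narrowSeq.T_isTree, fun v => ⟨narrowSeq.neighborSet_finite v, ?_⟩,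
    ?_, ?_, ?_, ?_⟩
  · have h1 := narrowSeq.ncard_neighborSet_le v
    have h2 := narrowSeq_c_le (narrowSeq.level v)
    omega
  · exact CriticalTreesExponentialGrowth_holds narrowSeq.T narrowSeq.T_isTree
      narrowSeq.neighborSet_finite (by rw [criticalProb_narrowSeq]; exact pstar_lt_one)
  · rw [criticalProb_narrowSeq]; exact pstar_pos
  · rw [criticalProb_narrowSeq]; exact pstar_lt_one
  · have h : (⟨criticalProb narrowSeq.T 0, criticalProb_mem_Icc narrowSeq.T 0⟩ : unitInterval) =
        pstarI := Subtype.ext criticalProb_narrowSeq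
    rw [h]
    exact theta_pstar_pos

end Literature.Barriers.CriticalPhenomena

end
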